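import Mathlib
import Literature.MathematicalPhysics.StatisticalMechanics.BarlowStacking
import Summits.AtomisticToContinuum.Crystallization.Theorems.HolmgrenBoyleLindHalfSpaceUniqueContinuationThickDefect

/-!
# Route `HolmgrenBoyleLind`, crux `HalfSpaceUniqueContinuation`: unique continuation in the
stacking direction for BARLOW stackings — two balanced Barlow stackings agreeing below a plane
are equal
Support file for the crux item stmt-AtomisticToContinuum-6075 (`HalfSpaceUniqueContinuation`,
line `registered`, lead c1): the first closed sub-class of the registered rank-2 stub
`stub_layeredOpenVanishing` (layered unique continuation in the stacking direction). For the
equal-spacing Barlow stackings of the tree (`barlowStacking a h s`: triangular layers of spacing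
`a` in the planes `x₃ = k h`, letters `A/B/C` coded by a Hägg sequence `s`,
`Literature/…/BarlowStacking.lean`) we prove, for ALL `a, h > 0` (no dominance condition, no
numerics):

* `hbl_barlowStacking_eq_of_agree_below` — if `barlowStacking a h s` (`s` a Hägg sequence) and
  `barlowStacking a h s'` are both in exact Lennard-Jones force balance and agree on a lower
  half-space `{x₃ < c}`, they are EQUAL.

Proof: a defect layer `k₁` carries two distinct letters `ℓ = L_s(k₁)`, `ℓ' = L_{s'}(k₁)`
(`hbl_barlowPos_mem_iff`); below the plane, of any two consecutive layers one avoids the third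
letter (`not_haggLabel_modEq_succ`), so the layers carrying `ℓ` or `ℓ'` form a harmonic row
(`Σ 1/depth = ∞`, `hbl_not_summable_inv_of_le_linear`), which splits between the two letters:
one of them, `L`, is THICK (`hbl_exists_thick_letter`). The defect point of letter `L` in layer
`k₁` then has, straight below it, an observer of the common lower stacking in every layer of
letter `L` (`hbl_barlow_below_mem`) — a non-Blaschke row on its normal line — and the local
thick-normal-line theorem `hbl_iff_of_thick_normal_line` (transverse Blaschke + clean segment +
blow-up, parts 5–7) says such a point is not a defect: contradiction.

Consequence to be drawn next (needs the symbolic lemma «a non-periodic sequence has two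
orbit-closure points with equal past and different present» and patch-hull membership of
orbit-closure stackings): every Barlow stacking in exact Lennard-Jones force balance is periodic.
All `[folklore]`; nothing here closes an item.
-/

noncomputable section

namespace Summit.AtomisticToContinuum.Crystallization.Theorems.HolmgrenBoyleLind

open scoped BigOperators Topology InnerProductSpace
open Literature.MathematicalPhysics.StatisticalMechanics
open Summit.AtomisticToContinuum.Crystallization.Theorems

local notation "𝔼" => EuclideanSpace ℝ (Fin 3)

/-! ## Letters of Barlow points -/

/-- Two Barlow points (same spacings `a ≠ 0`, `h ≠ 0`, possibly different Hägg sequences) that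
coincide lie in the same layer and carry the same letter `A/B/C` (labels congruent mod `3`).
[folklore] -/
theorem hbl_barlowPos_eq_imp {a h : ℝ} (ha : a ≠ 0) (hh : h ≠ 0) {s s' : ℤ → ℤ}
    {k i j k' i' j' : ℤ} (heq : barlowPos a h s k i j = barlowPos a h s' k' i' j') :
    k = k' ∧ haggLabel s k ≡ haggLabel s' k' [ZMOD 3] := by
  have h2 := congrArg (fun z : 𝔼 => z 2) heq
  have h1 := congrArg (fun z : 𝔼 => z 1) heq
  simp only [barlowPos_apply_two, barlowPos_apply_one] at h2 h1
  have hk : k = k' := by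
    have : (k : ℝ) = k' := mul_right_cancel₀ hh h2
    exact_mod_cast this
  refine ⟨hk, ?_⟩
  have h3 : (√3 : ℝ) ≠ 0 := by positivity
  have h1' : (j : ℝ) + haggLabel s k / 3 = j' + haggLabel s' k' / 3 := by
    have hc : a * √3 / 2 ≠ 0 := by positivity
    exact mul_left_cancel₀ hc h1
  have h4 : (haggLabel s k : ℝ) - haggLabel s' k' = 3 * ((j' : ℝ) - j) := by linarith
  have h5 : haggLabel s k - haggLabel s' k' = 3 * (j' - j) := by exact_mod_cast h4
  rw [Int.ModEq]
  omega

/-- A Barlow point of `s` lies in the stacking of `s'` iff its layer carries the same letter in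
both codings. [folklore] -/
theorem hbl_barlowPos_mem_iff {a h : ℝ} (ha : a ≠ 0) (hh : h ≠ 0) {s s' : ℤ → ℤ} (k i j : ℤ) :
    barlowPos a h s k i j ∈ barlowStacking a h s' ↔ haggLabel s k ≡ haggLabel s' k [ZMOD 3] := by
  constructor
  · rintro ⟨k', i', j', heq⟩
    obtain ⟨rfl, hmod⟩ := hbl_barlowPos_eq_imp ha hh heq
    exact hmod
  · intro hmod
    have hdvd : (3 : ℤ) ∣ haggLabel s k - haggLabel s' k := by
      rw [Int.ModEq] at hmod
      omega
    obtain ⟨q, hq⟩ := hdvd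
    have hL : haggLabel s k = haggLabel s' k + 3 * q := by linarith
    refine ⟨k, i + q, j + q, ?_⟩
    rw [barlowPos_eq_of_haggLabel_eq a h i j hL]
    simp

/-- **Columns.** If layer `k` of `s` carries the same letter as layer `k₁` of `s*`, the point of
layer `k` straight below `barlowPos a h s* k₁ i j` belongs to the stacking of `s`. [folklore] -/
theorem hbl_barlow_below_mem {a h : ℝ} {s s₁ : ℤ → ℤ} {k k₁ : ℤ} (i j : ℤ)
    (hmod : haggLabel s k ≡ haggLabel s₁ k₁ [ZMOD 3]) :
    barlowPos a h s₁ k₁ i j - (((k₁ : ℝ) - k) * h) • EuclideanSpace.single (2 : Fin 3) (1 : ℝ) ∈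
      barlowStacking a h s := by
  have hdvd : (3 : ℤ) ∣ haggLabel s₁ k₁ - haggLabel s k := by
    rw [Int.ModEq] at hmod
    omega
  obtain ⟨q, hq⟩ := hdvd
  have hL : haggLabel s₁ k₁ = haggLabel s k + 3 * q := by linarith
  refine ⟨k, i + q, j + q, ?_⟩
  rw [barlowPos_eq_of_haggLabel_eq a h i j hL]
  have he : (((k₁ : ℝ) - k) * h) • EuclideanSpace.single (2 : Fin 3) (1 : ℝ) =
      ((k₁ : ℝ) - k) • layerNormal h := by
    ext l
    fin_cases l <;> simp [layerNormal]
  rw [he, add_sub_cancel_right]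

/-! ## Letters mod 3: the third letter, consecutive layers -/

/-- Among the three letters, one differs from two given ones. [folklore] -/
theorem hbl_exists_third_letter (ℓ ℓ' : ℤ) :
    ∃ ρ : ℤ, ¬ ℓ ≡ ρ [ZMOD 3] ∧ ¬ ℓ' ≡ ρ [ZMOD 3] := by
  simp only [Int.ModEq]
  by_cases h0 : ℓ % 3 = 0 ∨ ℓ' % 3 = 0
  · by_cases h1 : ℓ % 3 = 1 ∨ ℓ' % 3 = 1
    · exact ⟨2, by omega, by omega⟩
    · exact ⟨1, by omega, by omega⟩
  · exact ⟨0, by omega, by omega⟩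

/-- A letter different from the third letter is one of the two given (distinct) ones. [folklore] -/
theorem hbl_letter_of_ne_third {ℓ ℓ' ρ L : ℤ} (hℓℓ' : ¬ ℓ ≡ ℓ' [ZMOD 3])
    (hρ : ¬ ℓ ≡ ρ [ZMOD 3]) (hρ' : ¬ ℓ' ≡ ρ [ZMOD 3]) (hL : ¬ L ≡ ρ [ZMOD 3]) :
    L ≡ ℓ [ZMOD 3] ∨ L ≡ ℓ' [ZMOD 3] := by
  simp only [Int.ModEq] at *
  omega

/-- Of two consecutive layers of a Barlow stacking, at least one does NOT carry a given letter.
[folklore] -/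
theorem hbl_exists_layer_ne_letter {s : ℤ → ℤ} (hs : IsHaggSeq s) (k ρ : ℤ) :
    ∃ k' : ℤ, (k' = k ∨ k' = k + 1) ∧ ¬ haggLabel s k' ≡ ρ [ZMOD 3] := by
  by_cases hk : haggLabel s k ≡ ρ [ZMOD 3]
  · refine ⟨k + 1, Or.inr rfl, fun hk1 => ?_⟩
    exact not_haggLabel_modEq_succ hs k (hk.trans hk1.symm)
  · exact ⟨k, Or.inl rfl, hk⟩

/-! ## A thick letter below -/

/-- **Harmonic rows.** If `1 ≤ t m ≤ C + D m` (`C, D > 0`) then `Σ 1/t m = ∞`. [folklore] -/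
theorem hbl_not_summable_inv_of_le_linear {t : ℕ → ℝ} {C D : ℝ} (hC : 0 < C) (hD : 0 < D)
    (ht : ∀ m, 1 ≤ t m) (hle : ∀ m, t m ≤ C + D * m) :
    ¬ Summable (fun m => (t m)⁻¹) := by
  intro hsum
  have hcmp : ∀ m : ℕ, (C + D)⁻¹ * (1 / ((m : ℝ) + 1)) ≤ (t m)⁻¹ := by
    intro m
    have hm : (0 : ℝ) ≤ m := m.cast_nonneg
    have h1 : t m ≤ (C + D) * ((m : ℝ) + 1) := by nlinarith [hle m]
    have h2 : 0 < t m := by linarith [ht m]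
    rw [one_div, ← mul_inv]
    exact (inv_le_inv₀ (by positivity) h2).2 h1
  have hs2 : Summable (fun m : ℕ => (C + D)⁻¹ * (1 / ((m : ℝ) + 1))) :=
    Summable.of_nonneg_of_le (fun m => by positivity) hcmp hsum
  have hs3 : Summable (fun m : ℕ => 1 / ((m : ℝ) + 1)) :=
    (summable_mul_left_iff (by positivity : (C + D)⁻¹ ≠ 0)).1 hs2
  have hs4 : Summable (fun m : ℕ => 1 / ((m : ℕ) : ℝ)) := by
    rw [← summable_nat_add_iff 1]
    simpa using hs3
  exact Real.not_summable_one_div_natCast hs4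

/-- **A thick letter.** Below any level, one of two distinct letters `ℓ, ℓ'` of a Barlow stacking
is THICK: there is an injective sequence of layers `f n ≤ k₀`, all carrying that letter, with
`Σ 1/(b − f n · h) = ∞` (for any `b > k₀ h`). Indeed of two consecutive layers one avoids the
third letter, hence carries `ℓ` or `ℓ'`; these layers form a harmonic row, which splits between
the two letters. [folklore] -/
theorem hbl_exists_thick_letter {s : ℤ → ℤ} (hs : IsHaggSeq s) {h b : ℝ} (hh : 0 < h) (k₀ : ℤ)
    (hb : (k₀ : ℝ) * h + 1 ≤ b) {ℓ ℓ' : ℤ} (hℓℓ' : ¬ ℓ ≡ ℓ' [ZMOD 3]) :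
    ∃ L : ℤ, (L = ℓ ∨ L = ℓ') ∧ ∃ f : ℕ → ℤ, Function.Injective f ∧ (∀ n, f n ≤ k₀) ∧
      (∀ n, haggLabel s (f n) ≡ L [ZMOD 3]) ∧ ¬ Summable (fun n => (b - f n * h)⁻¹) := by
  classical
  obtain ⟨ρ, hρ, hρ'⟩ := hbl_exists_third_letter ℓ ℓ'
  -- one good layer in each consecutive pair below `k₀`
  have hpair : ∀ m : ℕ, ∃ k' : ℤ, (k' = k₀ - 2 * m - 1 ∨ k' = k₀ - 2 * m - 1 + 1) ∧
      ¬ haggLabel s k' ≡ ρ [ZMOD 3] := fun m => hbl_exists_layer_ne_letter hs _ ρ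
  choose g hg1 hg2 using hpair
  have hg_le : ∀ m, g m ≤ k₀ - 2 * m := fun m => by rcases hg1 m with h1 | h1 <;> omega
  have hg_ge : ∀ m, k₀ - 2 * m - 1 ≤ g m := fun m => by rcases hg1 m with h1 | h1 <;> omega
  have hginj : Function.Injective g := by
    intro m n hmn
    have h1 := hg_le m; have h2 := hg_ge m; have h3 := hg_le n; have h4 := hg_ge n
    rw [hmn] at h1 h2
    omega
  -- the harmonic row `t m = b - g m * h`
  set t : ℕ → ℝ := fun m => b - g m * h with htdef
  have ht1 : ∀ m, 1 ≤ t m := by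
    intro m
    have h1 : ((g m : ℤ) : ℝ) ≤ k₀ := by exact_mod_cast (hg_le m).trans (by omega)
    show 1 ≤ b - g m * h
    nlinarith
  have htle : ∀ m, t m ≤ (b - k₀ * h + h) + (2 * h) * m := by
    intro m
    have h1 : ((k₀ : ℤ) : ℝ) - 2 * m - 1 ≤ g m := by exact_mod_cast hg_ge m
    show b - g m * h ≤ (b - k₀ * h + h) + (2 * h) * m
    nlinarith
  have hnot : ¬ Summable (fun m => (t m)⁻¹) :=
    hbl_not_summable_inv_of_le_linear (by linarith) (by linarith) ht1 htle
  -- split the row between the two letters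
  set A : Set ℕ := {m | haggLabel s (g m) ≡ ℓ [ZMOD 3]} with hA
  have hletter : ∀ m, m ∉ A → haggLabel s (g m) ≡ ℓ' [ZMOD 3] := by
    intro m hm
    rcases hbl_letter_of_ne_third hℓℓ' hρ hρ' (hg2 m) with h1 | h1
    · exact absurd h1 hm
    · exact h1
  have hsplit : ¬ Summable (A.indicator fun m => (t m)⁻¹) ∨
      ¬ Summable (Aᶜ.indicator fun m => (t m)⁻¹) := by
    by_contra hcon
    push Not at hcon
    apply hnot
    have := hcon.1.add hcon.2
    simp_rw [Set.indicator_self_add_compl_apply] at this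
    exact this
  -- a non-summable indicator has infinite support; enumerate it
  have hthick : ∀ (B : Set ℕ) (L : ℤ), (∀ m ∈ B, haggLabel s (g m) ≡ L [ZMOD 3]) →
      ¬ Summable (B.indicator fun m => (t m)⁻¹) →
      ∃ f : ℕ → ℤ, Function.Injective f ∧ (∀ n, f n ≤ k₀) ∧
        (∀ n, haggLabel s (f n) ≡ L [ZMOD 3]) ∧ ¬ Summable (fun n => (b - f n * h)⁻¹) := by
    intro B L hBL hB
    have hBinf : B.Infinite := by
      intro hfin
      apply hB
      refine summable_of_hasFiniteSupport ?_
      show (Function.support (B.indicator fun m => (t m)⁻¹)).Finite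
      exact hfin.subset Set.support_indicator_subset
    have hBinf' : (setOf fun m => m ∈ B).Infinite := by simpa using hBinf
    refine ⟨fun n => g (Nat.nth (· ∈ B) n), hginj.comp (Nat.nth_injective hBinf'),
      fun n => (hg_le _).trans (by omega), fun n => hBL _ (Nat.nth_mem_of_infinite hBinf' n), ?_⟩
    intro hsum
    apply hB
    have hrange : ∀ x ∉ Set.range (Nat.nth (· ∈ B)), B.indicator (fun m => (t m)⁻¹) x = 0 := by
      intro x hx
      rw [Nat.range_nth_of_infinite hBinf'] at hx
      exact Set.indicator_of_notMem hx _
    refine ((Nat.nth_injective hBinf').summable_iff hrange).1 ?_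
    have heq : (B.indicator fun m => (t m)⁻¹) ∘ Nat.nth (· ∈ B) = fun n => (b - g (Nat.nth (· ∈ B) n) * h)⁻¹ := by
      funext n
      simp only [Function.comp_apply]
      rw [Set.indicator_of_mem (Nat.nth_mem_of_infinite hBinf' n)]
    rw [heq]
    exact hsum
  rcases hsplit with h1 | h1
  · obtain ⟨f, hf⟩ := hthick A ℓ (fun m hm => hm) h1
    exact ⟨ℓ, Or.inl rfl, f, hf⟩
  · obtain ⟨f, hf⟩ := hthick Aᶜ ℓ' (fun m hm => hletter m hm) h1
    exact ⟨ℓ', Or.inr rfl, f, hf⟩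


/-! ## Unique continuation in the stacking direction for Barlow stackings -/

/-- **Two balanced Barlow stackings that agree below a horizontal plane are equal.** Let
`a, h > 0`, `s` a Hägg sequence and `s'` any label coding; if `barlowStacking a h s` and
`barlowStacking a h s'` are both in exact Lennard-Jones force balance and agree on `{x₃ < c}`,
then they coincide. (A defect layer exhibits two distinct letters; one of them is thick below
the plane, `hbl_exists_thick_letter`; the defect point of that letter sits on a non-Blaschke
observer column, `hbl_barlow_below_mem`, and `hbl_iff_of_thick_normal_line` forbids that.)
Valid for every `a, h > 0`: no dominance condition on `h/a`. [folklore] -/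
theorem hbl_barlowStacking_eq_of_agree_below :
    ∀ (a h : ℝ), 0 < a → 0 < h → ∀ (s s' : ℤ → ℤ), IsHaggSeq s →
      (∀ x ∈ barlowStacking a h s,
        HasSum (fun y : {y : EuclideanSpace ℝ (Fin 3) // y ∈ barlowStacking a h s ∧ y ≠ x} =>
          (deriv lennardJones (dist x y) / dist x y) • (x - (y : EuclideanSpace ℝ (Fin 3)))) 0) →
      (∀ x ∈ barlowStacking a h s',
        HasSum (fun y : {y : EuclideanSpace ℝ (Fin 3) // y ∈ barlowStacking a h s' ∧ y ≠ x} =>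
          (deriv lennardJones (dist x y) / dist x y) • (x - (y : EuclideanSpace ℝ (Fin 3)))) 0) →
      ∀ c : ℝ, (∀ z : EuclideanSpace ℝ (Fin 3), z 2 < c →
        (z ∈ barlowStacking a h s ↔ z ∈ barlowStacking a h s')) →
      barlowStacking a h s = barlowStacking a h s' := by
  intro a h ha hh s s' hs hbal hbal' c hagree
  classical
  -- separation and the unit normal
  have hδ : 0 < min a h := lt_min ha hh
  have hsep : ∀ x ∈ barlowStacking a h s, ∀ y ∈ barlowStacking a h s, x ≠ y → min a h ≤ dist x y :=
    fun x hx y hy hxy => le_dist_of_mem_barlowStacking a h s ha.le hh.le hx hy hxy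
  have hsep' : ∀ x ∈ barlowStacking a h s', ∀ y ∈ barlowStacking a h s', x ≠ y →
      min a h ≤ dist x y :=
    fun x hx y hy hxy => le_dist_of_mem_barlowStacking a h s' ha.le hh.le hx hy hxy
  set u : 𝔼 := EuclideanSpace.single (2 : Fin 3) (1 : ℝ) with hu
  have hun : ‖u‖ = 1 := by simp [hu]
  have hinner : ∀ z : 𝔼, ⟪z, u⟫_ℝ = z 2 := fun z => by
    simp [hu, EuclideanSpace.inner_single_right]
  have hagree' : ∀ z : 𝔼, ⟪z, u⟫_ℝ < c → (z ∈ barlowStacking a h s ↔ z ∈ barlowStacking a h s') :=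
    fun z hz => hagree z (by rwa [hinner] at hz)
  -- a defect layer `k₁`
  by_contra hne
  obtain ⟨k₁, hk₁⟩ : ∃ k₁ : ℤ, ¬ haggLabel s k₁ ≡ haggLabel s' k₁ [ZMOD 3] := by
    by_contra hall
    push Not at hall
    apply hne
    ext z
    constructor
    · rintro ⟨k, i, j, rfl⟩
      exact (hbl_barlowPos_mem_iff ha.ne' hh.ne' k i j).2 (hall k)
    · rintro ⟨k, i, j, rfl⟩
      exact (hbl_barlowPos_mem_iff ha.ne' hh.ne' k i j).2 (hall k).symm
  -- the defect layer lies on or above the plane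
  have hk₁c : c ≤ k₁ * h := by
    by_contra hlt
    push Not at hlt
    have hmem : barlowPos a h s k₁ 0 0 ∈ barlowStacking a h s' :=
      (hagree _ (by rwa [barlowPos_apply_two])).1 (barlowPos_mem k₁ 0 0)
    exact hk₁ ((hbl_barlowPos_mem_iff ha.ne' hh.ne' k₁ 0 0).1 hmem)
  -- a deep level `k₀` and a thick letter among the two defect letters
  set k₀ : ℤ := ⌊(c - 2) / h⌋ with hk₀def
  have hk₀ : (k₀ : ℝ) * h ≤ c - 2 := by
    have h1 : (k₀ : ℝ) ≤ (c - 2) / h := Int.floor_le _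
    rwa [le_div_iff₀ hh] at h1
  obtain ⟨L, hL, f, hfinj, hfle, hfL, hfsum⟩ :=
    hbl_exists_thick_letter hs hh k₀ (b := k₁ * h) (by linarith) hk₁
  -- the defect point `x₀` at the thick letter, and its observer row
  obtain ⟨x₀, hx₀def, hx₀2⟩ : ∃ x₀ : 𝔼, ¬ (x₀ ∈ barlowStacking a h s ↔ x₀ ∈ barlowStacking a h s') ∧
      (x₀ 2 = k₁ * h ∧ ∀ n, x₀ - (((k₁ : ℝ) - f n) * h) • u ∈ barlowStacking a h s) := by
    rcases hL with rfl | rfl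
    · refine ⟨barlowPos a h s k₁ 0 0, fun hiff => hk₁ ?_, barlowPos_apply_two a h s k₁ 0 0,
        fun n => hbl_barlow_below_mem 0 0 (hfL n)⟩
      exact (hbl_barlowPos_mem_iff ha.ne' hh.ne' k₁ 0 0).1 (hiff.1 (barlowPos_mem k₁ 0 0))
    · refine ⟨barlowPos a h s' k₁ 0 0, fun hiff => hk₁ ?_, barlowPos_apply_two a h s' k₁ 0 0,
        fun n => hbl_barlow_below_mem 0 0 (hfL n)⟩
      exact ((hbl_barlowPos_mem_iff ha.ne' hh.ne' k₁ 0 0).1 (hiff.2 (barlowPos_mem k₁ 0 0))).symm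
  obtain ⟨hx₀2, hrow⟩ := hx₀2
  set t : ℕ → ℝ := fun n => ((k₁ : ℝ) - f n) * h with htdef
  have ht : ∀ n, ⟪x₀, u⟫_ℝ - c + 2 ≤ t n := by
    intro n
    rw [hinner, hx₀2]
    have h1 : ((f n : ℤ) : ℝ) ≤ k₀ := by exact_mod_cast hfle n
    show k₁ * h - c + 2 ≤ ((k₁ : ℝ) - f n) * h
    nlinarith
  have htinj : Function.Injective t := by
    intro m n hmn
    have h1 : ((k₁ : ℝ) - f m) * h = ((k₁ : ℝ) - f n) * h := hmn
    have h2 : ((f m : ℤ) : ℝ) = f n := by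
      have := mul_right_cancel₀ hh.ne' h1
      linarith
    exact hfinj (by exact_mod_cast h2)
  have htsum : ¬ Summable (fun n => (t n)⁻¹) := by
    have heq : (fun n => (t n)⁻¹) = fun n => ((k₁ : ℝ) * h - f n * h)⁻¹ := by
      funext n
      simp only [htdef]
      ring_nf
    rw [heq]
    exact hfsum
  exact hx₀def (hbl_iff_of_thick_normal_line _ _ (min a h) hδ hsep hsep' hbal hbal' u c hun hagree'
    x₀ t ht htinj htsum hrow)

end Summit.AtomisticToContinuum.Crystallization.Theorems.HolmgrenBoyleLind

end
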